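import Literature.Computability.AlgebraicComplexity.PermanentUniversality
import Literature.Computability.Complexity.CNF
import HarnessLib

/-!
# The clause-product matrix of a CNF: `#SAT` as a Boolean sum of permanents (Valiant 1979, Lemma 3.1, first half)

Valiant's `#P`-hardness proof for the permanent (*The complexity of computing the permanent*,
TCS 8 (1979), Lemma 3.1, p. 193: "there is an `f ∈ FP` from CNF formulae to matrices with entries
from `{-1, 0, 1, 2, 3}` such that `Perm f(F) = 4^{t(F)} · s(F)`", `s(F)` the number of satisfying
assignments) superposes tracks, interchanges and junctions. The tree proves the junction step in
the form of Bürgisser–Clausen–Shokrollahi 1997, Thm. (21.29) (`PermanentBooleanSum.lean`: a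
Boolean sum `∑_{e ∈ {0,1}^t} per A(Y := e)` of permanents of a matrix `A` over `k ∪ {Y_j}` with
at most one variable per column is `16^{-occ}` times ONE permanent), so what `#SAT` needs in
addition is a matrix `A_φ` over `ℤ ∪ {Y_1, …, Y_t}` with the column property whose permanent,
after the Boolean substitution `Y := e`, is the indicator `[e ⊨ φ]`. This file constructs it as
the lower Hessenberg matrix of a weighted path-DAG (the calculus of `PermanentUniversality.lean`:
`per (hess n w) = pathSum w n`, series composition multiplies path sums):

* a literal `ℓ` on the variable `Y_v` is the DAG `0 →ˢ 1 →^{Y_v} 2` together with `0 →ᵖ 2`,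
  of path sum `p + s · Y_v`, with `(p, s) = (1, -1)` for a positive and `(0, 1)` for a negative
  literal, i.e. the polynomial `1 - ℓ` (`CNFPer.litW`, `CNFPer.litPoly`, `CNFPer.pathSum_litW`;
  all CNF-specific names live in the sub-namespace `CNFPer`);
* a clause `ℓ₁ ∨ ⋯ ∨ ℓ_w` is the series composition of its literals (nodes `0, …, 2w`, path sum
  `∏ᵢ (1 - ℓᵢ)`) followed by the edge `2w →^{-1} 2w+1` and the bypass `0 →¹ 2w+1`: path sum
  `1 - ∏ᵢ (1 - ℓᵢ) = [clause satisfied]` on Boolean points (`clauseW`, `clausePoly`,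
  `pathSum_clauseW`; the empty clause gets `1 + (-1) = 0`);
* a CNF is the series composition of its clauses (`cnfW`, `cnfDim φ = ∑ (2 wⱼ + 1)`, `cnfPoly`,
  `pathSum_cnfW`), and `cnfMatrix φ := symHess (cnfDim φ) (cnfW φ)` is its symbol matrix over
  `k ∪ X ∪ Y` (no `X`-entries are used; the slot is kept for compatibility with
  `PermanentBooleanSum.lean`), with constants in `{-1, 0, 1}`;
* `entryPer_cnfMatrix : per (cnfMatrix φ) = ∏_C (1 - ∏_{ℓ ∈ C} (1 - ℓ))`,
  `hasColumnProperty_cnfMatrix` (every variable entry sits alone in its column — in fact on the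
  diagonal), `entryPer_boolSubst_cnfMatrix : per (cnfMatrix φ)(Y := e) = [e ⊨ φ]` and
  `sum_entryPer_boolSubst_cnfMatrix : ∑_e per (cnfMatrix φ)(Y := e) = #{e | e ⊨ φ}`.

Variables are `Fin t` (the `Y`-block of the BCS matrices); CNFs over `ℕ` are renamed along
`φ.vars ≃ Fin t` downstream. The arithmetisation `∏_C (1 - ∏_{ℓ∈C}(1 - ℓ))` of a CNF is standard
(e.g. Arora–Barak 2009, §8.5.1/§17.4 style arithmetisation); the path-DAG realisation is the one
of BCS 1997, proof of Thm. (21.27) (`PermanentUniversality.lean`), written out by hand to obtain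
small explicit blocks (`2w + 1` nodes per clause of width `w`).

## References

* L. G. Valiant, *The complexity of computing the permanent*, Theoret. Comput. Sci. 8 (1979)
  189–201, Lemma 3.1 (p. 193) and its proof (pp. 194–196).
* P. Bürgisser, M. Clausen, M. A. Shokrollahi, *Algebraic Complexity Theory*, Springer 1997,
  Thm. (21.27) and its proof (path-DAG / Hessenberg normal form), Thm. (21.29).
-/

noncomputable section

open MvPolynomial Matrix Finset

namespace Literature.Computability.AlgebraicComplexity

open Literature.Computability.Complexity

universe u v

variable {k : Type u} [CommRing k] {σ : Type v} {t : ℕ}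

/-! ### Symbol Hessenberg matrices -/

/-- The lower Hessenberg SYMBOL matrix of a DAG with weights in `k ∪ X` (`hess` of
`PermanentUniversality.lean` with entries kept as symbols: `1` on the subdiagonal, the weight
`W r (c+1)` for `r ≤ c`, `0` below the subdiagonal). [cite: BurgisserClausenShokrollahi1997, Thm. (21.27) (C)] -/
def symHess {τ : Type*} (n : ℕ) (W : ℕ → ℕ → k ⊕ τ) : Matrix (Fin n) (Fin n) (k ⊕ τ) := fun r c =>
  if r.val = c.val + 1 then Sum.inl 1 else if r.val ≤ c.val then W r.val (c.val + 1) else Sum.inl 0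

/-- Read in the polynomial ring, the symbol Hessenberg matrix is `hess n (wval W)`. [cite: BurgisserClausenShokrollahi1997, Thm. (21.27) (C)] -/
theorem symHess_map {τ : Type*} (n : ℕ) (W : ℕ → ℕ → k ⊕ τ) :
    (symHess n W).map entryVal = hess n (wval W) := by
  ext r c
  simp only [Matrix.map_apply, symHess, hess, wval]
  split_ifs <;> simp

/-- The permanent of a symbol Hessenberg matrix is the path sum of its DAG. [cite: BurgisserClausenShokrollahi1997, Lemma (21.28)] -/
theorem entryPer_symHess {τ : Type*} (n : ℕ) (W : ℕ → ℕ → k ⊕ τ) :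
    entryPer (symHess n W) = pathSum (wval W) n := by
  rw [entryPer, symHess_map, permanent_hess]

/-- A symbol Hessenberg matrix of a DAG with property (D) has the column property. [cite: BurgisserClausenShokrollahi1997, Thm. (21.27) (D)] -/
theorem hasColumnProperty_symHess {τ : Type*} (n : ℕ) {W : ℕ → ℕ → k ⊕ τ} (hW : ColUnique W) :
    HasColumnProperty (symHess n W) := by
  intro j i i' hi hi'
  have key : ∀ r : Fin n, (symHess n W r j).isRight = true → (W r.val (j.val + 1)).isRight = true := by
    intro r hr
    simp only [symHess] at hr
    split_ifs at hr with h1 h2 <;> simp_all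
  exact Fin.ext (hW _ _ _ (key i hi) (key i' hi'))

/-- Variable entries of a symbol Hessenberg matrix come from variable weights `W r (c+1)` with
`r ≤ c`. [cite: BurgisserClausenShokrollahi1997, Thm. (21.27) (C)] -/
theorem symHess_eq_inr_iff {τ : Type*} (n : ℕ) (W : ℕ → ℕ → k ⊕ τ) (r c : Fin n) (y : τ) :
    symHess n W r c = Sum.inr y ↔ r.val ≤ c.val ∧ W r.val (c.val + 1) = Sum.inr y := by
  simp only [symHess]
  split_ifs with h1 h2
  · simp only [false_iff, not_and]; intro h; omega
  · simp [h2]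
  · simp only [false_iff, not_and]; intro h; omega

/-! ### Literals -/

namespace CNFPer

/-- The constant `p` of a literal: `1` for a positive, `0` for a negative literal. [cite: Valiant1979, Lemma 3.1] -/
def litP (l : Literal (Fin t)) : k := if l.2 then 1 else 0

/-- The constant `s` of a literal: `-1` for a positive, `1` for a negative literal. [cite: Valiant1979, Lemma 3.1] -/
def litS (l : Literal (Fin t)) : k := if l.2 then -1 else 1

/-- The DAG of a literal `ℓ` on the variable `Y_v`, on the nodes `{0, 1, 2}`: `0 → 1` of weight
`s`, `0 → 2` of weight `p`, `1 → 2` of weight `Y_v`; path sum `p + s Y_v = 1 - ℓ`. [cite: Valiant1979, Lemma 3.1] -/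
def litW (l : Literal (Fin t)) : ℕ → ℕ → k ⊕ (σ ⊕ Fin t) := fun a b =>
  if a = 0 ∧ b = 1 then Sum.inl (litS l)
  else if a = 0 ∧ b = 2 then Sum.inl (litP l)
  else if a = 1 ∧ b = 2 then Sum.inr (Sum.inr l.1)
  else Sum.inl 0

/-- The polynomial `1 - ℓ = p + s · Y_v` of a literal. [cite: Valiant1979, Lemma 3.1] -/
def litPoly (l : Literal (Fin t)) : MvPolynomial (σ ⊕ Fin t) k :=
  C (litP l) + C (litS l) * X (Sum.inr l.1)

/-- The path sum of the literal DAG is `1 - ℓ`. [cite: Valiant1979, Lemma 3.1] -/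
theorem pathSum_litW (l : Literal (Fin t)) :
    pathSum (wval (litW (k := k) (σ := σ) l)) 2 = litPoly l := by
  rw [pathSum_two]
  simp [wval, litW, litPoly]

/-- The literal DAG has property (D). [cite: BurgisserClausenShokrollahi1997, Thm. (21.27) (D)] -/
theorem colUnique_litW (l : Literal (Fin t)) : ColUnique (litW (k := k) (σ := σ) l) := by
  intro b a a' ha ha'
  simp only [litW] at ha ha'
  split_ifs at ha ha' <;> simp_all

/-- The zero DAG has property (D). [folklore] -/
theorem colUnique_zero : ColUnique (fun _ _ => (Sum.inl 0 : k ⊕ (σ ⊕ Fin t))) := by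
  intro b a a' ha
  simp at ha

/-! ### Clauses -/

/-- The chain of the literal DAGs of a clause (series composition; nodes `0, …, 2w`). [cite: Valiant1979, Lemma 3.1] -/
def litChainW : Clause (Fin t) → ℕ → ℕ → k ⊕ (σ ⊕ Fin t)
  | [] => fun _ _ => Sum.inl 0
  | l :: ls => seriesW 2 (litW l) (litChainW ls)

/-- The path sum of the chain is `∏ᵢ (1 - ℓᵢ)`. [cite: Valiant1979, Lemma 3.1] -/
theorem pathSum_litChainW : ∀ c : Clause (Fin t),
    pathSum (wval (litChainW (k := k) (σ := σ) c)) (2 * c.length) = (c.map litPoly).prod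
  | [] => by simp [pathSum_zero]
  | l :: ls => by
    rw [List.length_cons, show 2 * (ls.length + 1) = 2 + 2 * ls.length by ring, litChainW,
      pathSum_seriesW, pathSum_litW, pathSum_litChainW ls, List.map_cons, List.prod_cons]

/-- The chain has property (D). [cite: BurgisserClausenShokrollahi1997, Thm. (21.27) (D)] -/
theorem colUnique_litChainW : ∀ c : Clause (Fin t), ColUnique (litChainW (k := k) (σ := σ) c)
  | [] => colUnique_zero
  | l :: ls => colUnique_seriesW (colUnique_litW l) (colUnique_litChainW ls)

/-- The DAG of a clause of width `w` on the nodes `{0, …, 2w+1}`: the chain of its literals, the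
edge `2w → 2w+1` of weight `-1` and the bypass `0 → 2w+1` of weight `1` (for `w = 0` both fall on
the edge `0 → 1`, of weight `1 + (-1) = 0`). [cite: Valiant1979, Lemma 3.1] -/
def clauseW (c : Clause (Fin t)) : ℕ → ℕ → k ⊕ (σ ⊕ Fin t) := fun a b =>
  if b = 2 * c.length + 1 then
    Sum.inl ((if a = 0 then 1 else 0) + (if a = 2 * c.length then -1 else 0))
  else litChainW c a b

/-- The clause polynomial `1 - ∏ᵢ (1 - ℓᵢ)`. [cite: Valiant1979, Lemma 3.1] -/
def clausePoly (c : Clause (Fin t)) : MvPolynomial (σ ⊕ Fin t) k :=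
  1 - (c.map litPoly).prod

/-- The path sum of the clause DAG is the clause polynomial. [cite: Valiant1979, Lemma 3.1] -/
theorem pathSum_clauseW (c : Clause (Fin t)) :
    pathSum (wval (clauseW (k := k) (σ := σ) c)) (2 * c.length + 1) = clausePoly c := by
  rw [pathSum_succ]
  have hloc : ∀ a ∈ range (2 * c.length + 1),
      pathSum (wval (clauseW (k := k) (σ := σ) c)) a = pathSum (wval (litChainW c)) a := by
    intro a ha
    rw [mem_range] at ha
    refine pathSum_congr fun a' b hb => ?_
    have : b ≠ 2 * c.length + 1 := by omega
    simp [wval, clauseW, this]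
  have hw : ∀ a, wval (clauseW (k := k) (σ := σ) c) a (2 * c.length + 1) =
      (if a = 0 then 1 else 0) + (if a = 2 * c.length then -1 else 0) := by
    intro a
    simp only [wval, clauseW, if_true, entryVal_inl, map_add, apply_ite C, map_one, map_zero, map_neg]
  rw [Finset.sum_congr rfl fun a ha => by rw [hloc a ha, hw a]]
  simp_rw [mul_add, Finset.sum_add_distrib, mul_ite, mul_one, mul_zero, Finset.sum_ite_eq',
    mem_range]
  rw [if_pos (by omega), if_pos (by omega), pathSum_zero, pathSum_litChainW, clausePoly]
  ring

/-- The clause DAG has property (D). [cite: BurgisserClausenShokrollahi1997, Thm. (21.27) (D)] -/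
theorem colUnique_clauseW (c : Clause (Fin t)) : ColUnique (clauseW (k := k) (σ := σ) c) := by
  intro b a a' ha ha'
  simp only [clauseW] at ha ha'
  by_cases hb : b = 2 * c.length + 1
  · simp [hb] at ha
  · rw [if_neg hb] at ha ha'
    exact colUnique_litChainW c b a a' ha ha'

/-! ### CNFs -/

/-- The dimension of the CNF matrix: `∑_C (2 w_C + 1)`. [cite: Valiant1979, Lemma 3.1] -/
def cnfDim {ν : Type*} : CNF ν → ℕ
  | [] => 0
  | c :: cs => 2 * c.length + 1 + cnfDim cs

/-- `cnfDim` of a cons. [folklore] -/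
@[simp] theorem cnfDim_cons {ν : Type*} (c : Clause ν) (cs : CNF ν) :
    cnfDim (c :: cs) = 2 * c.length + 1 + cnfDim cs := rfl

/-- `cnfDim` of the empty CNF. [folklore] -/
@[simp] theorem cnfDim_nil {ν : Type*} : cnfDim ([] : CNF ν) = 0 := rfl

/-- The DAG of a CNF: the series composition of its clause DAGs. [cite: Valiant1979, Lemma 3.1] -/
def cnfW : CNF (Fin t) → ℕ → ℕ → k ⊕ (σ ⊕ Fin t)
  | [] => fun _ _ => Sum.inl 0
  | c :: cs => seriesW (2 * c.length + 1) (clauseW c) (cnfW cs)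

/-- The CNF polynomial `∏_C (1 - ∏_{ℓ ∈ C} (1 - ℓ))`. [cite: Valiant1979, Lemma 3.1] -/
def cnfPoly (φ : CNF (Fin t)) : MvPolynomial (σ ⊕ Fin t) k :=
  (φ.map clausePoly).prod

/-- The path sum of the CNF DAG is the CNF polynomial. [cite: Valiant1979, Lemma 3.1] -/
theorem pathSum_cnfW : ∀ φ : CNF (Fin t),
    pathSum (wval (cnfW (k := k) (σ := σ) φ)) (cnfDim φ) = cnfPoly φ
  | [] => by simp [cnfPoly, pathSum_zero]
  | c :: cs => by
    rw [cnfDim_cons, cnfW, pathSum_seriesW, pathSum_clauseW, pathSum_cnfW cs]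
    simp [cnfPoly]

/-- The CNF DAG has property (D). [cite: BurgisserClausenShokrollahi1997, Thm. (21.27) (D)] -/
theorem colUnique_cnfW : ∀ φ : CNF (Fin t), ColUnique (cnfW (k := k) (σ := σ) φ)
  | [] => colUnique_zero
  | c :: cs => colUnique_seriesW (colUnique_clauseW c) (colUnique_cnfW cs)

/-- **The clause-product matrix of a CNF** `φ` with variables `Y_1, …, Y_t`: the symbol Hessenberg
matrix (size `cnfDim φ = ∑_C (2 w_C + 1)`, constants in `{-1, 0, 1}`) of the series composition of
the clause DAGs. This is the matrix to which the Boolean-sum elimination of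
`PermanentBooleanSum.lean` is applied in Valiant's reduction `#SAT → Per`. [cite: Valiant1979, Lemma 3.1] -/
def cnfMatrix (φ : CNF (Fin t)) : Matrix (Fin (cnfDim φ)) (Fin (cnfDim φ)) (k ⊕ (σ ⊕ Fin t)) :=
  symHess (cnfDim φ) (cnfW φ)

/-- **`per (cnfMatrix φ)` is the CNF polynomial** `∏_C (1 - ∏_{ℓ ∈ C} (1 - ℓ))`. [cite: Valiant1979, Lemma 3.1] -/
theorem entryPer_cnfMatrix (φ : CNF (Fin t)) : entryPer (cnfMatrix (k := k) (σ := σ) φ) = cnfPoly φ := by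
  rw [cnfMatrix, entryPer_symHess, pathSum_cnfW]

/-- **The clause-product matrix has the column property** (at most one variable per column). [cite: BurgisserClausenShokrollahi1997, Thm. (21.29)] -/
theorem hasColumnProperty_cnfMatrix (φ : CNF (Fin t)) :
    HasColumnProperty (cnfMatrix (k := k) (σ := σ) φ) :=
  hasColumnProperty_symHess _ (colUnique_cnfW φ)

/-! ### Boolean points -/

/-- The value of `1 - ℓ` at a Boolean point: `[ℓ false]`. [cite: Valiant1979, Lemma 3.1] -/
theorem aeval_litPoly (e : Fin t → Bool) (l : Literal (Fin t)) :
    aeval (Sum.elim X fun j => if e j then (1 : MvPolynomial σ k) else 0) (litPoly (k := k) (σ := σ) l) =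
      if l.eval e then 0 else 1 := by
  rcases l with ⟨v, b⟩
  simp only [litPoly, litP, litS, map_add, map_mul, aeval_C, aeval_X, Sum.elim_inr, Literal.eval]
  cases b <;> by_cases h : e v = true <;> simp [h]

/-- The value of the clause polynomial at a Boolean point: `[clause satisfied]`. [cite: Valiant1979, Lemma 3.1] -/
theorem aeval_clausePoly (e : Fin t → Bool) (c : Clause (Fin t)) :
    aeval (Sum.elim X fun j => if e j then (1 : MvPolynomial σ k) else 0) (clausePoly (k := k) (σ := σ) c) =
      if Clause.eval e c then 1 else 0 := by
  have hprod : aeval (Sum.elim X fun j => if e j then (1 : MvPolynomial σ k) else 0)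
      ((c.map (litPoly (k := k) (σ := σ))).prod) = if c.any (Literal.eval e) then 0 else 1 := by
    induction c with
    | nil => simp
    | cons l ls ih =>
      rw [List.map_cons, List.prod_cons, map_mul, ih, aeval_litPoly, List.any_cons]
      cases Literal.eval e l <;> cases ls.any (Literal.eval e) <;> simp
  unfold clausePoly
  rw [map_sub, map_one, hprod, Clause.eval]
  cases c.any (Literal.eval e) <;> simp

/-- The value of the CNF polynomial at a Boolean point: `[e ⊨ φ]`. [cite: Valiant1979, Lemma 3.1] -/
theorem aeval_cnfPoly (e : Fin t → Bool) (φ : CNF (Fin t)) :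
    aeval (Sum.elim X fun j => if e j then (1 : MvPolynomial σ k) else 0) (cnfPoly (k := k) (σ := σ) φ) =
      if φ.eval e then 1 else 0 := by
  induction φ with
  | nil => simp [cnfPoly]
  | cons c cs ih =>
    simp only [cnfPoly, List.map_cons, List.prod_cons, map_mul] at ih ⊢
    rw [ih, aeval_clausePoly, CNF.eval_cons]
    cases Clause.eval e c <;> cases CNF.eval cs e <;> simp

/-- **Boolean substitution gives the satisfaction indicator**: `per (cnfMatrix φ)(Y := e) = [e ⊨ φ]`. [cite: Valiant1979, Lemma 3.1] -/
theorem entryPer_boolSubst_cnfMatrix (φ : CNF (Fin t)) (e : Fin t → Bool) :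
    entryPer (boolSubst (cnfMatrix (k := k) (σ := σ) φ) e) = if φ.eval e then 1 else 0 := by
  rw [entryPer_boolSubst, entryPer_cnfMatrix]
  exact aeval_cnfPoly e φ

/-- **`#SAT` as a Boolean sum of permanents**: `∑_{e ∈ {0,1}^t} per (cnfMatrix φ)(Y := e)` is the
number of satisfying assignments `e : Fin t → Bool` of `φ` (Valiant 1979, Lemma 3.1: "`s(F)` is
the number of assignments that satisfy `F`"). [cite: Valiant1979, Lemma 3.1] -/
theorem sum_entryPer_boolSubst_cnfMatrix (φ : CNF (Fin t)) :
    ∑ e : Fin t → Bool, entryPer (boolSubst (cnfMatrix (k := k) (σ := σ) φ) e) =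
      C (((univ.filter fun e : Fin t → Bool => φ.eval e = true).card : ℕ) : k) := by
  simp_rw [entryPer_boolSubst_cnfMatrix]
  rw [Finset.sum_ite, Finset.sum_const_zero, add_zero, Finset.sum_const, nsmul_eq_mul, mul_one,
    map_natCast]

end CNFPer

end Literature.Computability.AlgebraicComplexity
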